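/-
COR-CM (cell pub-hodgecm2, stage 2 of the Hodge ladder) — junction B01 `PerLFace_of_PerL`, sequel «UisoInflation» of
`HOME/b01/ROUTES-B01.md` (§7 L1-C / L2-B): the MODEL side of the common-reflex junction on the universe of record —
pull-backs of CM eigen-forms from ANY abelian variety realising an inflation of a sub-pair `(M′, Φ′)` of `(K, Ψ)` lie in
`U_Ψ(Γ)` (`Model.span_pull_eigenline_le_Uiso`).  Tree port of §2 of the stage-1 package module
`HodgeCM/Model/UisoOfCommonReflex.lean` over the tree Literature brick `CommonReflexSpan` (b01 g39 CR-PORT, p251884 ✔).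
PORT AUTHORED by prover-pub-hodgecm2-b01-g39-0 (staged bytes `HOME/pub-hodgecm2-b01/work-CR-PORT/UisoOfCommonReflexRec.lean`,
md5 5fd3a99fc5a3, farm rc 0 as a concatenation), FILED (this header added; `variable` binders written explicitly) by the single owner of B01,
prover-pub-hodgecm2-own-b01-0, per RULING CR-PORT (b) (lead gen 5, 2026-08-21T06:10Z).  Theorems only; nothing cited as a
record; nothing asserted.
-/
import Literature.AlgebraicGeometry.ComplexMultiplication.CommonReflexSpan
import Summits.HodgeConjecture.CorCM.Model.PerLConeFacts
import HarnessLib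

/-!
# Pull-backs of common-reflex CM eigen-forms lie in the isotypic block `Uiso` (model universe)

ON THE MODEL UNIVERSE `U = Model.universeOf hHD hI hU h₃` / `Model.picardCMUniverse hHD hI h₁ h₃`: for a CM field `K`,
a CM type `Ψ` of `K` and `σ ∈ Ψ`, a CM pair `(M', Φ')` with `k₁ : M' → K` inflating `Φ'` to `Ψ`, a number field `M`
with `k₂ : M' → M`, an abelian variety `A` realising the `k₂`-inflated type, and `τ : M → ℂ` with `τ ∘ k₂ = σ ∘ k₁`:
the `ℂ`-span of the classes `(f^*)_ℂ α` on the surface `U.pms L ι₁ V Γ` — `f` a morphism from THE realised surface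
to `A`, `α` in the `τ`-eigenline of `ℂ ⊗ H¹(A; ℚ)` — is contained in `U.Uiso Γ K Ψ σ`.

Proof: a generator `(f^*)_ℂ α` has `α = Σ_j d_j (u_j^*)_ℂ β_j` with `u_j : A → A_{(K,Ψ)}` and `β_j` in the
`σ`-eigenline of the universe's CM action (`CommonReflex.eigenline_le_span_pull_eigenline_coded`, with `C` a
realisation of `(M', Φ')` taken from record (iii) itself); that eigenline IS `U.eigenLine K Ψ σ` (`rfl`)
`= U.alphaLine K Ψ σ` (M14 `universeOf_fact_alphaLine`, `σ ∈ Ψ`), and `(f^*)_ℂ (u_j^*)_ℂ β_j = U.pullC (f ≫ u_j) 1 β_j`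
(`BettiUniverse.pull_comp`).  Input beyond the universe's rows: Riemann's fullness `hR` (a hypothesis here; the tree
theorem `deligneMilne1982_Thm_6_20_full_holds` discharges it).

USE: the MODEL side of the (J-Liu-iso) junction (stage 1: E's binder `hsmall`; stage 2: the discharge of B01-L
`FaceLineField` through Liu's `A_μ` / Albanese factors, ROUTES-B01 §2 (g), §5).
-/

noncomputable section

open scoped TensorProduct
open NumberField CategoryTheory Module

namespace Summit.HodgeConjecture.CorCM

open Literature.AlgebraicGeometry.Motives (CMType AbelianVariety bettiCohomology)
open Literature.AlgebraicGeometry.HodgeTheory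
open Literature.AlgebraicGeometry.HodgeTheory.BettiUniverse (pull pull_comp cmAction IsInducedOnIntegers)
open Literature.AlgebraicGeometry.ComplexMultiplication (IsCMTypeRealisation)
open Literature.AlgebraicGeometry.ComplexMultiplication.CommonReflex (complexify eigenline_le_span_pull_eigenline_coded)
open Literature.NumberTheory.Automorphic.PicardCM

/-- A generator of `Uiso`: the pull-back `U.pullC F 1 α` of a holomorphic `σ`-eigen one-form `α ∈ U.alphaLine K Ψ σ`
along a morphism `F : P_Γ → A_{(K,Ψ)}` lies in `U.Uiso Γ K Ψ σ` (by definition of the span). -/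
theorem Universe.pullC_alphaLine_mem_Uiso (U : Universe) {L : CMField} {ι₁ : L →+* ℂ} {V : HermSpace3 L ι₁}
    (Γ : Level V) (K : CMField) (Ψ : CMType K) (σ : K →+* ℂ) (F : U.Mor (U.pms L ι₁ V Γ) (U.cmAV K Ψ))
    {α : U.CohC (U.cmAV K Ψ) 1} (hα : α ∈ U.alphaLine K Ψ σ) : U.pullC F 1 α ∈ U.Uiso Γ K Ψ σ :=
  Submodule.subset_span ⟨F, α, hα, rfl⟩

namespace Model


/-- **Pull-backs of common-reflex CM eigen-forms lie in `Uiso`** (model universe `universeOf hHD hI hU h₃`).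
`K` a CM field with CM type `Ψ`, `σ ∈ Ψ`; `(M', Φ')` a CM pair with `k₁ : M' → K` and `Ψ = Φ'^K`
(`τ ∈ Ψ ↔ τ ∘ k₁ ∈ Φ'`); `M` a number field with `k₂ : M' → M`, `Φ_A = Φ'^M`, `(A, ι_A, θ_A)` a realisation of
`(M; Φ_A)`; `τ : M → ℂ` with `τ ∘ k₂ = σ ∘ k₁`.  Then every `ℂ`-combination of classes `(f^*)_ℂ α` on the realised surface
`U.pms L ι₁ V Γ` — `f` a morphism of the realised surface to `A`, `α` a `τ`-eigenvector of `ℂ ⊗ H¹(A; ℚ)` — lies in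
`U.Uiso Γ K Ψ σ`.  Inputs beyond the universe's rows: Riemann's fullness `hR`. -/
theorem universeOf_span_pull_eigenline_le_Uiso (hHD : exists_isReal_hodgeModel) (hI : hodgePQ_independent_of_hodgeModel)
    (hU : BallQuotientUniformisedDatum) (h₃ : CMAbelianVarietyRealised)
    {L : CMField} {ι₁ : L →+* ℂ} (V : HermSpace3 L ι₁) (Γ : Level V)
    (K : CMField) (Ψ : CMType K) {σ : K →+* ℂ} (hσ : σ ∈ Ψ.1)
    {M' : Type} [Field M'] [NumberField M'] [IsCMField M'] {Φ' : CMType M'} (k₁ : M' →+* K)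
    (hΨ : ∀ τ : K →+* ℂ, τ ∈ Ψ.1 ↔ τ.comp k₁ ∈ Φ'.1)
    {M : Type} [Field M] [NumberField M] (k₂ : M' →+* M) {ΦA : CMType M}
    (hΦA : ∀ τ : M →+* ℂ, τ ∈ ΦA.1 ↔ τ.comp k₂ ∈ Φ'.1)
    {A : AbelianVariety ℂ} {ιA : 𝓞 M →+* End A} {θA : M →+* Module.End ℂ (complexBetti A.X 1)}
    (hA : IsCMTypeRealisation ΦA A ιA θA) (hθA : IsInducedOnIntegers θA)
    (hR : DeligneMilne1982_Thm_6_20_full)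
    {τ : M →+* ℂ} (hστ : τ.comp k₂ = σ.comp k₁) :
    Submodule.span ℂ {x : (universeOf hHD hI hU h₃).CohC ((universeOf hHD hI hU h₃).pms L ι₁ V Γ) 1 |
        ∃ (f : (pmsRealisation hU (pmsCode L ι₁ V Γ)).X ⟶ A.X) (α : ℂ ⊗[ℚ] bettiCohomology A.X 1),
          α ∈ eigenline (complexify (cmAction θA hθA)) τ ∧ x = (pull f 1).baseChange ℂ α}
      ≤ (universeOf hHD hI hU h₃).Uiso Γ K Ψ σ := by
  -- a realisation `C` of the base pair, from record (iii) itself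
  obtain ⟨C, ιC, θC, hC⟩ := h₃ M' Φ'
  have hC' : IsCMTypeRealisation Φ' C ιC θC := hC
  -- the universe's `A_{(K,Ψ)}`: the chosen realisation of the code, acting through `cmCodeEquiv K Ψ`
  have hB : IsCMTypeRealisation (cmCode K Ψ).Φ (cmRealisation h₃ (cmCode K Ψ)).AV
      (cmRealisation h₃ (cmCode K Ψ)).ι (cmRealisation h₃ (cmCode K Ψ)).θ :=
    ⟨(cmRealisation h₃ _).isSmoothProjective, (cmRealisation h₃ _).finrank_eq, (cmRealisation h₃ _).map_ι,
      fun σ' ↦ ⟨(cmRealisation h₃ _).finrank_eigenline σ', (cmRealisation h₃ _).hodgeType_of_mem σ',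
        (cmRealisation h₃ _).hodgeType_of_not_mem σ'⟩⟩
  have hΦ₁ : ∀ τ' : (cmCode K Ψ).E →+* ℂ,
      τ' ∈ (cmCode K Ψ).Φ.1 ↔ (τ'.comp (cmCodeEquiv K Ψ).toRingHom).comp k₁ ∈ Φ'.1 :=
    fun τ' ↦ (show τ' ∈ (cmCode K Ψ).Φ.1 ↔ τ'.comp (cmCodeEquiv K Ψ).toRingHom ∈ Ψ.1 from Iff.rfl).trans
      (hΨ _)
  have hle := eigenline_le_span_pull_eigenline_coded k₁ k₂ hR hI hC' (cmCodeEquiv K Ψ) hΦ₁ hB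
    ((cmRealisation h₃ (cmCode K Ψ)).exists_map_comp (cmCodeEquiv K Ψ)) hΦA hA hθA hστ
  rw [Submodule.span_le]
  rintro x ⟨f, α, hα, rfl⟩
  have key : Submodule.map ((pull f 1).baseChange ℂ)
      (Submodule.span ℂ {x | ∃ (u : A.X ⟶ (cmRealisation h₃ (cmCode K Ψ)).AV.X)
        (β : ℂ ⊗[ℚ] bettiCohomology (cmRealisation h₃ (cmCode K Ψ)).AV.X 1),
        β ∈ eigenline (complexify (cmAction ((cmRealisation h₃ (cmCode K Ψ)).θ.comp
          (cmCodeEquiv K Ψ).toRingHom) ((cmRealisation h₃ (cmCode K Ψ)).exists_map_comp (cmCodeEquiv K Ψ)))) σ ∧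
        x = (pull u 1).baseChange ℂ β}) ≤ (universeOf hHD hI hU h₃).Uiso Γ K Ψ σ := by
    rw [Submodule.map_span_le]
    rintro m ⟨u, β, hβ, rfl⟩
    -- `β ∈ U.alphaLine K Ψ σ = U.eigenLine K Ψ σ` (M14, `σ ∈ Ψ`), and `U.eigenLine K Ψ σ` IS this eigenline (`rfl`)
    have hβ' : (β : (universeOf hHD hI hU h₃).CohC ((universeOf hHD hI hU h₃).cmAV K Ψ) 1) ∈
        (universeOf hHD hI hU h₃).alphaLine K Ψ σ := by
      rw [((universeOf_fact_alphaLine hHD hI hU h₃) K Ψ σ).1 hσ]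
      exact hβ
    -- the composite AS a morphism `P_Γ → A_{(K,Ψ)}` of the universe (`U.Mor _ _` unfolds to the scheme morphisms, `rfl`)
    let F : (universeOf hHD hI hU h₃).Mor ((universeOf hHD hI hU h₃).pms L ι₁ V Γ)
        ((universeOf hHD hI hU h₃).cmAV K Ψ) := f ≫ u
    have hgen := Universe.pullC_alphaLine_mem_Uiso (universeOf hHD hI hU h₃) Γ K Ψ σ F hβ'
    -- `(f^*)_ℂ ((u^*)_ℂ β) = ((f ≫ u)^*)_ℂ β = U.pullC F 1 β`
    have heq : ((pull f 1).baseChange ℂ) (((pull u 1).baseChange ℂ) β) =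
        (universeOf hHD hI hU h₃).pullC F 1 β := by
      show _ = (pull (f ≫ u) 1).baseChange ℂ β
      rw [pull_comp, LinearMap.baseChange_comp]
      rfl
    rw [heq]
    exact hgen
  exact key (Submodule.mem_map_of_mem (hle hα))

section PicardCM


/-- The same on the end-state universe `picardCMUniverse hHD hI h₁ h₃`. -/
theorem span_pull_eigenline_le_Uiso (hHD : exists_isReal_hodgeModel) (hI : hodgePQ_independent_of_hodgeModel)
    (h₁ : BallQuotientUniformised) (h₃ : CMAbelianVarietyRealised)
    {L : CMField} {ι₁ : L →+* ℂ} (V : HermSpace3 L ι₁) (Γ : Level V)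
    (K : CMField) (Ψ : CMType K) {σ : K →+* ℂ} (hσ : σ ∈ Ψ.1)
    {M' : Type} [Field M'] [NumberField M'] [IsCMField M'] {Φ' : CMType M'} (k₁ : M' →+* K)
    (hΨ : ∀ τ : K →+* ℂ, τ ∈ Ψ.1 ↔ τ.comp k₁ ∈ Φ'.1)
    {M : Type} [Field M] [NumberField M] (k₂ : M' →+* M) {ΦA : CMType M}
    (hΦA : ∀ τ : M →+* ℂ, τ ∈ ΦA.1 ↔ τ.comp k₂ ∈ Φ'.1)
    {A : AbelianVariety ℂ} {ιA : 𝓞 M →+* End A} {θA : M →+* Module.End ℂ (complexBetti A.X 1)}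
    (hA : IsCMTypeRealisation ΦA A ιA θA) (hθA : IsInducedOnIntegers θA)
    (hR : DeligneMilne1982_Thm_6_20_full)
    {τ : M →+* ℂ} (hστ : τ.comp k₂ = σ.comp k₁) :
    Submodule.span ℂ {x : (picardCMUniverse hHD hI h₁ h₃).CohC
        ((picardCMUniverse hHD hI h₁ h₃).pms L ι₁ V Γ) 1 |
        ∃ (f : (pmsRealisation (ballQuotientUniformisedDatum_of h₁) (pmsCode L ι₁ V Γ)).X ⟶ A.X)
          (α : ℂ ⊗[ℚ] bettiCohomology A.X 1),
          α ∈ eigenline (complexify (cmAction θA hθA)) τ ∧ x = (pull f 1).baseChange ℂ α}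
      ≤ (picardCMUniverse hHD hI h₁ h₃).Uiso Γ K Ψ σ :=
  universeOf_span_pull_eigenline_le_Uiso hHD hI _ h₃ V Γ K Ψ hσ k₁ hΨ k₂ hΦA hA hθA hR hστ

end PicardCM

end Model

end Summit.HodgeConjecture.CorCM

end
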